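import Mathlib.Algebra.Group.Subgroup.Pointwise
import Mathlib.GroupTheory.QuotientGroup.Basic
import Mathlib.Topology.Algebra.OpenSubgroup
import Mathlib.Data.Set.Finite.Basic
import HarnessLib

/-!
# The coset index of a finite level: pairs `(S, xS)` with the left action, base points with stabiliser `S`,
# and the permutation induced by an automorphism ([SemiAnbd] Ex. 3.10 p. 44: `Δ_i = Δ/N_i` acting on the
# cusps of the level-`i` covering; §6 p. 71: `I_x` read as a stabiliser)

Mochizuki, *Semi-graphs of anabelioids*, Publ. RIMS **42** (2006) [SemiAnbd], Example 3.10 p. 44 («semi-graphs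
of anabelioids `𝒢_i`, `𝒢^c_i` on which `Δ_i` acts faithfully»; the cusps of the covering determined by `N_i` are
permuted by `Δ_i = Δ/N_i`, the cusps over a cusp `x` being the cosets `Δ/(I_x N_i)` with stabiliser `I_x N_i / N_i`)
and §6 p. 71 («`I_x = D_x ∩ Δ^temp_X`») [cite: MochizukiSemiAnbd2006, Ex 3.10 p.44].

Pure group theory (abc-iut cell, layer L3, seat abc-iut-L3-t11 gen 6, step (B4a) of the row «NV-hLG@cusped» /
«CUSP-ABS·NONDEGENERATE-NV»): the edge INDEX of the level fibres of the cusped tower and everything the four clauses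
of the levelwise cusp–graph binder `hLG` (`TemperedCuspidalAbsolutenessOfProCusps.lean`) need from it.  For a group
`Q` (a finite level `Δ/N_i`):

* `CuspCoset.Index Q` — the pairs `(S, C)` with `S ≤ Q` a subgroup and `C = x·S` one of its left cosets (ALL
  subgroups at once, so that the index is stable under every automorphism of `Q`; no dependent types);
* `CuspCoset.act : Q →* Equiv.Perm (Index Q)` — `q · (S, C) = (S, qC)`; `basePt S = (S, S)` with
  **`act_basePt_eq_iff : act q (basePt S) = basePt S ↔ q ∈ S`** (the stabiliser reading);
* `CuspCoset.autPerm φ : Equiv.Perm (Index Q)` for `φ : Q ≃* Q` — `(S, C) ↦ (φ S, φ C)`, with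
  **`autPerm_act : autPerm φ (act q p) = act (φ q) (autPerm φ p)`** (equivariance: the `FI` of clause 3 of `hLG`)
  and **`autPerm_basePt : autPerm φ (basePt S) = basePt (S.map φ)`** (cusp matching: clause 4 of `hLG`).

No instance, no notation, no `Prop` fact; nothing here bears on [IUTchIII] Cor. 3.12.
-/

namespace Literature.AnabelianGeometry.SemiGraphs

namespace CuspCoset

open scoped Pointwise

universe u

variable (Q : Type u) [Group Q]

/-- **The coset index** of a level: pairs `(S, C)` of a subgroup `S ≤ Q` and a left coset `C = x·S` of it.
[cite: MochizukiSemiAnbd2006, Ex 3.10 p.44] -/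
def Index : Type u := {p : Subgroup Q × Set Q // ∃ x : Q, p.2 = x • (p.1 : Set Q)}

variable {Q}

/-- Extensionality of the coset index. [cite: MochizukiSemiAnbd2006, Ex 3.10 p.44] -/
theorem Index.ext {p p' : Index Q} (h1 : p.1.1 = p'.1.1) (h2 : p.1.2 = p'.1.2) : p = p' :=
  Subtype.ext (Prod.ext h1 h2)

/-- The index is finite for a finite level. [cite: MochizukiSemiAnbd2006, Ex 3.10 p.44] -/
theorem Index.finite [Finite Q] : Finite (Index Q) := by
  haveI : Finite (Set Q) := inferInstance
  refine Finite.of_injective (fun p : Index Q => ((p.1.1 : Set Q), p.1.2)) ?_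
  intro p p' h
  obtain ⟨h1, h2⟩ := Prod.mk.inj h
  exact Index.ext (SetLike.coe_injective h1) h2

variable (Q) in
/-- **The base point of `S`**: the pair `(S, S)` (the level cusp lying under the pro-cusp).
[cite: MochizukiSemiAnbd2006, Ex 3.10 p.44] -/
def basePt (S : Subgroup Q) : Index Q := ⟨(S, (S : Set Q)), ⟨1, by rw [one_smul]⟩⟩

/-- The base point, unfolded. [cite: MochizukiSemiAnbd2006, Ex 3.10 p.44] -/
@[simp] theorem basePt_val (S : Subgroup Q) : (basePt Q S).1 = (S, (S : Set Q)) := rfl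

/-! ## 1. The left action `q · (S, C) = (S, qC)` -/

/-- The left translation of a coset pair. [cite: MochizukiSemiAnbd2006, Ex 3.10 p.44] -/
def smul (q : Q) (p : Index Q) : Index Q :=
  ⟨(p.1.1, q • p.1.2), by
    obtain ⟨x, hx⟩ := p.2
    exact ⟨q * x, by rw [hx, smul_smul]⟩⟩

/-- The left translation, unfolded. [cite: MochizukiSemiAnbd2006, Ex 3.10 p.44] -/
@[simp] theorem smul_val (q : Q) (p : Index Q) : (smul q p).1 = (p.1.1, q • p.1.2) := rfl

/-- `1` acts trivially. [cite: MochizukiSemiAnbd2006, Ex 3.10 p.44] -/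
theorem one_smul' (p : Index Q) : smul 1 p = p := Index.ext rfl (by simp)

/-- The action is multiplicative. [cite: MochizukiSemiAnbd2006, Ex 3.10 p.44] -/
theorem mul_smul' (q q' : Q) (p : Index Q) : smul (q * q') p = smul q (smul q' p) :=
  Index.ext rfl (by simp [mul_smul])

variable (Q) in
/-- **The level action** `Q → Perm(Index Q)`, `q · (S, C) = (S, qC)` (Example 3.10: `Δ_i` permuting the cusps of
the level-`i` covering). [cite: MochizukiSemiAnbd2006, Ex 3.10 p.44] -/
def act : Q →* Equiv.Perm (Index Q) where
  toFun q :=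
    { toFun := smul q
      invFun := smul q⁻¹
      left_inv := fun p => by rw [← mul_smul', inv_mul_cancel, one_smul']
      right_inv := fun p => by rw [← mul_smul', mul_inv_cancel, one_smul'] }
  map_one' := Equiv.ext one_smul'
  map_mul' q q' := Equiv.ext (mul_smul' q q')

/-- The action, unfolded. [cite: MochizukiSemiAnbd2006, Ex 3.10 p.44] -/
@[simp] theorem act_apply (q : Q) (p : Index Q) : act Q q p = smul q p := rfl

/-- **THE STABILISER READING**: `q` fixes the base point of `S` iff `q ∈ S` (p. 71: the inertia group as the
stabiliser of the cusp; at a finite level, `Stab(S, S) = S`). [cite: MochizukiSemiAnbd2006, §6 p.71] -/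
theorem act_basePt_eq_iff (q : Q) (S : Subgroup Q) : act Q q (basePt Q S) = basePt Q S ↔ q ∈ S := by
  constructor
  · intro h
    have h2 : q • (S : Set Q) = S := by
      have := congrArg (fun p : Index Q => p.1.2) h
      simpa using this
    have : q • (1 : Q) ∈ q • (S : Set Q) := Set.smul_mem_smul_set S.one_mem
    rw [h2, smul_eq_mul, mul_one] at this
    exact this
  · intro hq
    exact Index.ext rfl (by simpa using smul_coe_set hq)

/-- Through a homomorphism `f : G → Q`: `g` fixes the base point of `S` iff `f g ∈ S`.
[cite: MochizukiSemiAnbd2006, §6 p.71] -/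
theorem act_comp_basePt_eq_iff {G : Type*} [Group G] (f : G →* Q) (g : G) (S : Subgroup Q) :
    ((act Q).comp f) g (basePt Q S) = basePt Q S ↔ f g ∈ S :=
  act_basePt_eq_iff (f g) S

/-! ## 2. The permutation induced by an automorphism of the level -/

/-- The transport of a coset pair along an automorphism: `(S, C) ↦ (φ S, φ C)`.
[cite: MochizukiSemiAnbd2006, Cor 3.11 p.47] -/
def autFun (φ : Q ≃* Q) (p : Index Q) : Index Q :=
  ⟨(p.1.1.map φ.toMonoidHom, φ '' p.1.2), by
    obtain ⟨x, hx⟩ := p.2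
    refine ⟨φ x, ?_⟩
    rw [hx, Set.image_smul_distrib, Subgroup.coe_map]
    rfl⟩

/-- The transport, unfolded. [cite: MochizukiSemiAnbd2006, Cor 3.11 p.47] -/
@[simp] theorem autFun_val (φ : Q ≃* Q) (p : Index Q) : (autFun φ p).1 = (p.1.1.map φ.toMonoidHom, φ '' p.1.2) :=
  rfl

/-- Transport along `φ` then `φ⁻¹` is the identity. [cite: MochizukiSemiAnbd2006, Cor 3.11 p.47] -/
theorem autFun_symm_autFun (φ : Q ≃* Q) (p : Index Q) : autFun φ.symm (autFun φ p) = p := by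
  refine Index.ext ?_ ?_
  · rw [autFun_val, autFun_val, Subgroup.map_map]
    convert Subgroup.map_id p.1.1
    ext x
    simp
  · rw [autFun_val, autFun_val]
    exact φ.toEquiv.symm_image_image p.1.2

/-- **The permutation of the coset index induced by an automorphism `φ` of the level** (the `F_i` of Cor. 3.11's
levelwise isomorphisms, at `Y = X`). [cite: MochizukiSemiAnbd2006, Cor 3.11 p.47] -/
def autPerm (φ : Q ≃* Q) : Equiv.Perm (Index Q) where
  toFun := autFun φ
  invFun := autFun φ.symm
  left_inv := autFun_symm_autFun φ
  right_inv p := by simpa using autFun_symm_autFun φ.symm p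

/-- The permutation, unfolded. [cite: MochizukiSemiAnbd2006, Cor 3.11 p.47] -/
@[simp] theorem autPerm_apply (φ : Q ≃* Q) (p : Index Q) : autPerm φ p = autFun φ p := rfl

/-- **EQUIVARIANCE** (clause 3 of `hLG`): `autPerm φ (q · p) = φ(q) · autPerm φ p`.
[cite: MochizukiSemiAnbd2006, Cor 3.11 p.46] -/
theorem autPerm_act (φ : Q ≃* Q) (q : Q) (p : Index Q) : autPerm φ (act Q q p) = act Q (φ q) (autPerm φ p) := by
  refine Index.ext rfl ?_
  simp [Set.image_smul_distrib]

/-- **CUSP MATCHING** (clause 4 of `hLG`): `autPerm φ` carries the base point of `S` to the base point of `φ(S)`.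
[cite: MochizukiSemiAnbd2006, Cor 3.11 p.47] -/
theorem autPerm_basePt (φ : Q ≃* Q) (S : Subgroup Q) : autPerm φ (basePt Q S) = basePt Q (S.map φ.toMonoidHom) := by
  refine Index.ext rfl ?_
  rw [autPerm_apply, autFun_val, basePt_val, basePt_val, Subgroup.coe_map]
  rfl

/-! ## 3. The pro-cusp reading along an exhaustive tower -/

/-- **The pro-cusp reading of a closed subgroup**: in a compact group `Δ`, a CLOSED subgroup `I` is the
intersection of the `I·N_i` over any family of normal subgroups `N_i` shrinking into every neighbourhood of `1`.
GLOSS, not a quotation of the paper (a cross-page synthesis of Ex. 3.10 p. 44, the exhaustive sequence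
`⋯ ⊆ N_i ⊆ ⋯ ⊆ Δ` of open characteristic subgroups, with §6 p. 71, `I_x = D_x ∩ Δ^temp_X`): `⋂_i I_x N_i = I_x`
since `I_x` is compact and the `N_i` are exhaustive — the level-`i` stabilisers cut out exactly the inertia
group. [cite: MochizukiSemiAnbd2006, §6 p.71] -/
theorem mem_of_forall_mem_sup {Δ : Type*} [Group Δ] [TopologicalSpace Δ] [IsTopologicalGroup Δ]
    [CompactSpace Δ] (I : Subgroup Δ) (hI : IsClosed (I : Set Δ)) {κ : Type*} (N : κ → Subgroup Δ)
    [hN : ∀ i, (N i).Normal] (hbasis : ∀ U : Set Δ, IsOpen U → (1 : Δ) ∈ U → ∃ i, (N i : Set Δ) ⊆ U)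
    {g : Δ} (hg : ∀ i, g ∈ I ⊔ N i) : g ∈ I := by
  by_contra hgI
  -- the compact set `g⁻¹ I` misses `1`, so some `N i` misses it
  have hclosed : IsClosed ((fun x => g⁻¹ * x) '' (I : Set Δ)) :=
    (Homeomorph.mulLeft g⁻¹).isClosedMap _ hI
  have h1 : (1 : Δ) ∈ ((fun x => g⁻¹ * x) '' (I : Set Δ))ᶜ := by
    rintro ⟨x, hx, hx1⟩
    apply hgI
    have : x = g := by
      have := congrArg (fun y => g * y) hx1
      simpa using this
    rw [← this]; exact hx
  obtain ⟨i, hi⟩ := hbasis _ hclosed.isOpen_compl h1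
  -- but `g ∈ I ⊔ N i = I · N i` (`N i` normal) gives `g = x n`, and `n⁻¹ = g⁻¹ x ∈ N i ∩ g⁻¹ I`
  have hg' : g ∈ ((I : Set Δ) * (N i : Set Δ)) := by
    rw [← Subgroup.mul_normal]; exact hg i
  obtain ⟨x, hx, n, hn, hxn⟩ := Set.mem_mul.mp hg'
  have hninv : n⁻¹ ∈ (fun y => g⁻¹ * y) '' (I : Set Δ) :=
    ⟨x, hx, by simp only; rw [← hxn, mul_inv_rev, inv_mul_cancel_right]⟩
  exact hi ((N i).inv_mem hn) hninv

end CuspCoset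

end Literature.AnabelianGeometry.SemiGraphs
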